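import Summits.CriticalPhenomena.PercolationContinuityZ3.Theorems.PercNearOneGluingNoHeavyLowerTailMergeGainTools
import HarnessLib

/-!
# `NoHeavyLowerTail` (stmt-CriticalPhenomena-4575) — the TWO-FORMAL-UNITS inequality (corner `C₀₀` / "FF" of the
# `2+2` kernel): both two-port children replaced by all-or-nothing units

Support file (lemma factory `prim-lf-3` gen 7, seat g9; `--supports stmt-CriticalPhenomena-4575`).  No definitions, no
named facts, no sorries.  Memo: `run/shared/lean/prim/prim-lf-3/LF3-BETA-R.md` §4; lead memo `prim-nh-lead-4575/KERNEL-BETA-R-TORUS.md`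
(§1(c): the kernel for two 2-port pendant stars over an arbitrary core reduces to this corner).

Setting (`Fin n`, core weights `w`, distinct ports `p₁,p₂` (pair `e_P`) and `q₁,q₂` (pair `e_Q`), witness `j`, numbers `u,v ∈ [0,1]`).
Weightings: `wP := w[e_P ↦ 1]`, `wQ := w[e_Q ↦ 1]`, `wPQ := w[e_P ↦ 1][e_Q ↦ 1]` (the two pairs glued SEPARATELY) and `wM := wPQ[s(q₁,p₁) ↦ 1]`
(everything MERGED).  With `(z − j)_ξ := μ_ξ(z ↔ b) − μ_ξ(j ↔ b)`:  `α_P := (p₁ − j)_{wP}`, `α_Q := (q₁ − j)_{wQ}`, `β := (p₁ − j)_{wPQ}`, `β′ := (q₁ − j)_{wPQ}`,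
`δ := (p₁ − j)_{wM}`.  The target is

   `C := u(1−v)·α_P + (1−u)v·α_Q + uv·δ ≥ 0`.

Hypotheses of `twoFormalUnits_core`: the SPLIT ROWS of the four ports, `0 ≤ (1−u)(1−v)(p − j)_w + u(1−v)(p − j)_{wP} + (1−u)v(p − j)_{wQ} + uv(p − j)_{wPQ}`
(and the same for `q`); the two "row at the far end" inequalities `M_P := (1−v)α_P + vβ ≥ 0`, `M_Q := (1−u)α_Q + uβ′ ≥ 0` (Lemma 5 in the ordinary graph
`K + (e_P : u) + (e_Q : v)`; supplied by the caller); and the case hypothesis `α_P ≥ 0 ∨ α_Q ≥ 0 ∨ (a good port exists)` — a port `p_i` with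
`μ_{wQ}(p_i ↔ b) ≤ μ_{wQ}(q₁ ↔ b)` or a port `q_k` with `μ_{wP}(q_k ↔ b) ≤ μ_{wP}(p₁ ↔ b)`.  [The memo's NO-ALL-BAD lemma says the case hypothesis always holds;
its Lean proof (quantitative gluing lemma + Harris) is a separate file.]

Proof (memo §4): `mergeGain_ge` + `anchoredExchange` give `δ − β′ ≥ 0` whenever `α_Q ≤ 0` and `δ − β ≥ 0` whenever `α_P ≤ 0` (the anchored exchange with the
hypothesis on the WITNESS: no lighter/heavier-block condition); Case A (`α_P, α_Q ≥ 0`): `δ ≥ 0` by two pair-gluings (Lemma 5); Case B: the identity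
`C = (1−v)u·α_P + v·[M_Q + u(δ − β′)]`; Case DH: the identity `C = (1−u)v(q₁ − p)_{wQ} + (1−u)(1−v)(j − p)_w + row_p + uv(δ − β)` for a good port `p`.
-/

namespace Summit.CriticalPhenomena.PercolationContinuityZ3.Theorems

open MeasureTheory Set ProbabilityTheory
open Literature.Probability.LatticeModels
open Literature.Probability.Percolation

noncomputable section
open Classical

namespace UpsetExchange

variable {n : ℕ}

/-- **Two formal units (corner `C₀₀`).**  See the module docstring.
[cite: KozmaNitzan2024, Lemma 5, Lemma 3(i), Question 9 (pp. 6, 13, 36); VandenbergHaggstromKahn2005, Thm. 1.2] -/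
theorem twoFormalUnits_core (w : Sym2 (Fin n) → unitInterval) (p₁ p₂ q₁ q₂ j b : Fin n)
    (hp : p₁ ≠ p₂) (hq : q₁ ≠ q₂) (hpq : p₁ ≠ q₁)
    {u v : ℝ} (hu0 : 0 ≤ u) (hu1 : u ≤ 1) (hv0 : 0 ≤ v) (hv1 : v ≤ 1)
    (hMP : 0 ≤ (1 - v) * ((prodBernoulli (fun f : Sym2 (Fin n) => if f = s(p₁, p₂) then 1 else w f)).real (openConn p₁ b) -
        (prodBernoulli (fun f : Sym2 (Fin n) => if f = s(p₁, p₂) then 1 else w f)).real (openConn j b)) +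
      v * ((prodBernoulli (fun f : Sym2 (Fin n) => if f = s(p₁, p₂) then 1 else if f = s(q₁, q₂) then 1 else w f)).real (openConn p₁ b) -
        (prodBernoulli (fun f : Sym2 (Fin n) => if f = s(p₁, p₂) then 1 else if f = s(q₁, q₂) then 1 else w f)).real (openConn j b)))
    (hMQ : 0 ≤ (1 - u) * ((prodBernoulli (fun f : Sym2 (Fin n) => if f = s(q₁, q₂) then 1 else w f)).real (openConn q₁ b) -
        (prodBernoulli (fun f : Sym2 (Fin n) => if f = s(q₁, q₂) then 1 else w f)).real (openConn j b)) +
      u * ((prodBernoulli (fun f : Sym2 (Fin n) => if f = s(p₁, p₂) then 1 else if f = s(q₁, q₂) then 1 else w f)).real (openConn q₁ b) -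
        (prodBernoulli (fun f : Sym2 (Fin n) => if f = s(p₁, p₂) then 1 else if f = s(q₁, q₂) then 1 else w f)).real (openConn j b)))
    (hrow : ∀ z ∈ ({p₁, p₂, q₁, q₂} : Finset (Fin n)), 0 ≤
      (1 - u) * (1 - v) * ((prodBernoulli w).real (openConn z b) - (prodBernoulli w).real (openConn j b)) +
      u * (1 - v) * ((prodBernoulli (fun f : Sym2 (Fin n) => if f = s(p₁, p₂) then 1 else w f)).real (openConn z b) -
        (prodBernoulli (fun f : Sym2 (Fin n) => if f = s(p₁, p₂) then 1 else w f)).real (openConn j b)) +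
      (1 - u) * v * ((prodBernoulli (fun f : Sym2 (Fin n) => if f = s(q₁, q₂) then 1 else w f)).real (openConn z b) -
        (prodBernoulli (fun f : Sym2 (Fin n) => if f = s(q₁, q₂) then 1 else w f)).real (openConn j b)) +
      u * v * ((prodBernoulli (fun f : Sym2 (Fin n) => if f = s(p₁, p₂) then 1 else if f = s(q₁, q₂) then 1 else w f)).real (openConn z b) -
        (prodBernoulli (fun f : Sym2 (Fin n) => if f = s(p₁, p₂) then 1 else if f = s(q₁, q₂) then 1 else w f)).real (openConn j b)))
    (hcase : 0 ≤ (prodBernoulli (fun f : Sym2 (Fin n) => if f = s(p₁, p₂) then 1 else w f)).real (openConn p₁ b) -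
          (prodBernoulli (fun f : Sym2 (Fin n) => if f = s(p₁, p₂) then 1 else w f)).real (openConn j b) ∨
        0 ≤ (prodBernoulli (fun f : Sym2 (Fin n) => if f = s(q₁, q₂) then 1 else w f)).real (openConn q₁ b) -
          (prodBernoulli (fun f : Sym2 (Fin n) => if f = s(q₁, q₂) then 1 else w f)).real (openConn j b) ∨
        (∃ z ∈ ({p₁, p₂} : Finset (Fin n)),
          (prodBernoulli (fun f : Sym2 (Fin n) => if f = s(q₁, q₂) then 1 else w f)).real (openConn z b) ≤
            (prodBernoulli (fun f : Sym2 (Fin n) => if f = s(q₁, q₂) then 1 else w f)).real (openConn q₁ b)) ∨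
        (∃ z ∈ ({q₁, q₂} : Finset (Fin n)),
          (prodBernoulli (fun f : Sym2 (Fin n) => if f = s(p₁, p₂) then 1 else w f)).real (openConn z b) ≤
            (prodBernoulli (fun f : Sym2 (Fin n) => if f = s(p₁, p₂) then 1 else w f)).real (openConn p₁ b))) :
    0 ≤ u * (1 - v) * ((prodBernoulli (fun f : Sym2 (Fin n) => if f = s(p₁, p₂) then 1 else w f)).real (openConn p₁ b) -
          (prodBernoulli (fun f : Sym2 (Fin n) => if f = s(p₁, p₂) then 1 else w f)).real (openConn j b)) +
      (1 - u) * v * ((prodBernoulli (fun f : Sym2 (Fin n) => if f = s(q₁, q₂) then 1 else w f)).real (openConn q₁ b) -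
          (prodBernoulli (fun f : Sym2 (Fin n) => if f = s(q₁, q₂) then 1 else w f)).real (openConn j b)) +
      u * v * ((prodBernoulli (fun f : Sym2 (Fin n) => if f = s(q₁, p₁) then 1 else
                  if f = s(p₁, p₂) then 1 else if f = s(q₁, q₂) then 1 else w f)).real (openConn p₁ b) -
          (prodBernoulli (fun f : Sym2 (Fin n) => if f = s(q₁, p₁) then 1 else
                  if f = s(p₁, p₂) then 1 else if f = s(q₁, q₂) then 1 else w f)).real (openConn j b)) := by
  -- weightings
  set wP : Sym2 (Fin n) → unitInterval := fun f => if f = s(p₁, p₂) then 1 else w f with hwP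
  set wQ : Sym2 (Fin n) → unitInterval := fun f => if f = s(q₁, q₂) then 1 else w f with hwQ
  set wPQ : Sym2 (Fin n) → unitInterval := fun f => if f = s(p₁, p₂) then 1 else if f = s(q₁, q₂) then 1 else w f with hwPQ
  set wM : Sym2 (Fin n) → unitInterval := fun f => if f = s(q₁, p₁) then 1 else
    if f = s(p₁, p₂) then 1 else if f = s(q₁, q₂) then 1 else w f with hwM
  have hwPQ' : wPQ = fun f => if f = s(p₁, p₂) then 1 else wQ f := by funext f; simp only [hwPQ, hwQ]
  have hwQP : (fun f : Sym2 (Fin n) => if f = s(q₁, q₂) then (1 : unitInterval) else wP f) = wPQ := by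
    funext f
    simp only [hwPQ, hwP]
    by_cases h1 : f = s(q₁, q₂)
    · rw [if_pos h1]
      by_cases h2 : f = s(p₁, p₂)
      · rw [if_pos h2]
      · rw [if_neg h2, if_pos h1]
    · rw [if_neg h1]
      by_cases h2 : f = s(p₁, p₂)
      · rw [if_pos h2, if_pos h2]
      · rw [if_neg h2, if_neg h2, if_neg h1]
  have hwM' : wM = fun f => if f = s(q₁, p₁) then 1 else wPQ f := by funext f; simp only [hwM, hwPQ]
  have hwM'' : (fun f : Sym2 (Fin n) => if f = s(p₁, q₁) then (1 : unitInterval) else wPQ f) = wM := by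
    rw [hwM']; funext f; rw [Sym2.eq_swap]
  -- representative equalities for glued pairs
  have hrepP : (prodBernoulli wP).real (openConn p₂ b) = (prodBernoulli wP).real (openConn p₁ b) := by
    have h := real_openConn_pair_eq w hp b; rw [h.1, h.2]
  have hrepQ : (prodBernoulli wQ).real (openConn q₂ b) = (prodBernoulli wQ).real (openConn q₁ b) := by
    have h := real_openConn_pair_eq w hq b; rw [h.1, h.2]
  have hrepPQp : (prodBernoulli wPQ).real (openConn p₂ b) = (prodBernoulli wPQ).real (openConn p₁ b) := by
    have h := real_openConn_pair_eq wQ hp b; rw [hwPQ']; rw [h.1, h.2]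
  have hrepPQq : (prodBernoulli wPQ).real (openConn q₂ b) = (prodBernoulli wPQ).real (openConn q₁ b) := by
    have h := real_openConn_pair_eq wP hq b; rw [← hwQP]; rw [h.1, h.2]
  have hrepM : (prodBernoulli wM).real (openConn q₁ b) = (prodBernoulli wM).real (openConn p₁ b) := by
    have h := real_openConn_pair_eq wPQ (Ne.symm hpq) b; rw [hwM']; rw [h.1, h.2]
  -- the rows (representatives rewritten)
  have hr1 := hrow p₁ (by simp)
  have hr2 := hrow p₂ (by simp)
  have hr3 := hrow q₁ (by simp)
  have hr4 := hrow q₂ (by simp)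
  rw [hrepP, hrepPQp] at hr2
  rw [hrepQ, hrepPQq] at hr4
  -- abbreviations
  set aP : ℝ := (prodBernoulli wP).real (openConn p₁ b) - (prodBernoulli wP).real (openConn j b) with haP
  set aQ : ℝ := (prodBernoulli wQ).real (openConn q₁ b) - (prodBernoulli wQ).real (openConn j b) with haQ
  set bP : ℝ := (prodBernoulli wPQ).real (openConn p₁ b) - (prodBernoulli wPQ).real (openConn j b) with hbP
  set bQ : ℝ := (prodBernoulli wPQ).real (openConn q₁ b) - (prodBernoulli wPQ).real (openConn j b) with hbQ
  set dM : ℝ := (prodBernoulli wM).real (openConn p₁ b) - (prodBernoulli wM).real (openConn j b) with hdM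
  -- (D_QP) α_Q ≤ 0 ⟹ dM − bQ ≥ 0   (anchored exchange on base wQ, block P, v = q₁, a = j; then merge-gain bookkeeping)
  have hDQP : aQ ≤ 0 → 0 ≤ dM - bQ := by
    intro h
    have hle : (prodBernoulli wQ).real (openConn q₁ b) ≤ (prodBernoulli wQ).real (openConn j b) := by linarith [h, haQ]
    have hx := anchoredExchange wQ ({p₁, p₂} : Finset (Fin n)) q₁ j b p₁ (by simp) hle
    rw [glue_pair_eq wQ hp, ← hwPQ'] at hx
    have hm := mergeGain_ge wPQ (Ne.symm hpq) j b
    rw [← hwM'] at hm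
    rw [hdM, hbQ, ← hrepM]
    linarith
  -- (D_PQ) α_P ≤ 0 ⟹ dM − bP ≥ 0
  have hDPQ : aP ≤ 0 → 0 ≤ dM - bP := by
    intro h
    have hle : (prodBernoulli wP).real (openConn p₁ b) ≤ (prodBernoulli wP).real (openConn j b) := by linarith [h, haP]
    have hx := anchoredExchange wP ({q₁, q₂} : Finset (Fin n)) p₁ j b q₁ (by simp) hle
    rw [glue_pair_eq wP hq, hwQP] at hx
    have hm := mergeGain_ge wPQ hpq j b
    rw [hwM''] at hm
    rw [hdM, hbP]
    linarith
  -- (L5²) α_P ≥ 0 ⟹ dM ≥ 0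
  have hA : 0 ≤ aP → 0 ≤ dM := by
    intro h
    have hle : (prodBernoulli wP).real (openConn j b) ≤ (prodBernoulli wP).real (openConn p₁ b) := by linarith [h, haP]
    have h1 := pairGlue_le wP hpq j b hle
    set w1 : Sym2 (Fin n) → unitInterval := fun f => if f = s(p₁, q₁) then 1 else wP f with hw1
    have hrep1 : (prodBernoulli w1).real (openConn q₁ b) = (prodBernoulli w1).real (openConn p₁ b) := by
      have h' := real_openConn_pair_eq wP hpq b; rw [h'.1, h'.2]
    have h2 := pairGlue_le w1 hq j b (by rw [hrep1]; exact h1)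
    have hw2 : (fun f : Sym2 (Fin n) => if f = s(q₁, q₂) then (1 : unitInterval) else w1 f) = wM := by
      funext f
      simp only [hw1, hwM, hwP]
      by_cases c1 : f = s(q₁, q₂)
      · rw [if_pos c1]
        by_cases c2 : f = s(q₁, p₁)
        · rw [if_pos c2]
        · rw [if_neg c2]
          by_cases c3 : f = s(p₁, p₂)
          · rw [if_pos c3]
          · rw [if_neg c3, if_pos c1]
      · rw [if_neg c1]
        by_cases c2 : f = s(p₁, q₁)
        · rw [if_pos c2, if_pos (c2.trans Sym2.eq_swap)]
        · have c2' : f ≠ s(q₁, p₁) := fun h' => c2 (h'.trans Sym2.eq_swap)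
          rw [if_neg c2, if_neg c2']
          by_cases c3 : f = s(p₁, p₂)
          · rw [if_pos c3, if_pos c3]
          · rw [if_neg c3, if_neg c3, if_neg c1]
    have hrepM' := hrepM
    rw [hw2] at h2
    rw [hdM]; linarith
  -- dangerousness: α_P < 0 ⟹ w-reliability of each p-port is below j's (Lemma 5 for the pair, contrapositive)
  have hdangP : aP < 0 → (prodBernoulli w).real (openConn p₁ b) < (prodBernoulli w).real (openConn j b) ∧
      (prodBernoulli w).real (openConn p₂ b) < (prodBernoulli w).real (openConn j b) := by
    intro h
    constructor
    · by_contra hc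
      have h1 := pairGlue_le w hp j b (not_lt.mp hc)
      linarith [h1, haP]
    · by_contra hc
      have h1 := pairGlue_le w (Ne.symm hp) j b (not_lt.mp hc)
      have hsw : (fun f : Sym2 (Fin n) => if f = s(p₂, p₁) then (1 : unitInterval) else w f) = wP := by
        funext f; rw [Sym2.eq_swap]
      rw [hsw, hrepP] at h1
      linarith [h1, haP]
  have hdangQ : aQ < 0 → (prodBernoulli w).real (openConn q₁ b) < (prodBernoulli w).real (openConn j b) ∧
      (prodBernoulli w).real (openConn q₂ b) < (prodBernoulli w).real (openConn j b) := by
    intro h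
    constructor
    · by_contra hc
      have h1 := pairGlue_le w hq j b (not_lt.mp hc)
      linarith [h1, haQ]
    · by_contra hc
      have h1 := pairGlue_le w (Ne.symm hq) j b (not_lt.mp hc)
      have hsw : (fun f : Sym2 (Fin n) => if f = s(q₂, q₁) then (1 : unitInterval) else w f) = wQ := by
        funext f; rw [Sym2.eq_swap]
      rw [hsw, hrepQ] at h1
      linarith [h1, haQ]
  -- goal in the abbreviations
  change 0 ≤ u * (1 - v) * aP + (1 - u) * v * aQ + u * v * dM
  have huv : 0 ≤ u * v := mul_nonneg hu0 hv0
  have hu1v : 0 ≤ u * (1 - v) := mul_nonneg hu0 (by linarith)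
  have h1uv : 0 ≤ (1 - u) * v := mul_nonneg (by linarith) hv0
  have h1u1v : 0 ≤ (1 - u) * (1 - v) := mul_nonneg (by linarith) (by linarith)
  by_cases cP : 0 ≤ aP
  · by_cases cQ : 0 ≤ aQ
    · -- Case A
      have hd := hA cP
      have t1 := mul_nonneg hu1v cP
      have t2 := mul_nonneg h1uv cQ
      have t3 := mul_nonneg huv hd
      exact add_nonneg (add_nonneg t1 t2) t3
    · -- Case B: C = (1−v)u·aP + v·[M_Q + u(dM − bQ)]
      have hd := hDQP (le_of_lt (lt_of_not_ge cQ))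
      have t1 := mul_nonneg hu1v cP
      have t2 : 0 ≤ v * ((1 - u) * aQ + u * bQ) := mul_nonneg hv0 hMQ
      have t3 := mul_nonneg huv hd
      have key : u * (1 - v) * aP + (1 - u) * v * aQ + u * v * dM =
          u * (1 - v) * aP + v * ((1 - u) * aQ + u * bQ) + u * v * (dM - bQ) := by ring
      rw [key]
      exact add_nonneg (add_nonneg t1 t2) t3
  · by_cases cQ : 0 ≤ aQ
    · -- Case B′
      have hd := hDPQ (le_of_lt (lt_of_not_ge cP))
      have t1 := mul_nonneg h1uv cQ
      have t2 : 0 ≤ u * ((1 - v) * aP + v * bP) := mul_nonneg hu0 hMP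
      have t3 := mul_nonneg huv hd
      have key : u * (1 - v) * aP + (1 - u) * v * aQ + u * v * dM =
          (1 - u) * v * aQ + u * ((1 - v) * aP + v * bP) + u * v * (dM - bP) := by ring
      rw [key]
      exact add_nonneg (add_nonneg t1 t2) t3
    · -- Case DH: both D's, a good port from `hcase`
      have cP' : aP < 0 := lt_of_not_ge cP
      have cQ' : aQ < 0 := lt_of_not_ge cQ
      have hd1 := hDPQ (le_of_lt cP')
      have hd2 := hDQP (le_of_lt cQ')
      obtain ⟨gp1, gp2⟩ := hdangP cP'
      obtain ⟨gq1, gq2⟩ := hdangQ cQ'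
      rcases hcase with h | h | ⟨z, hz, hgood⟩ | ⟨z, hz, hgood⟩
      · exact absurd h cP
      · exact absurd h cQ
      · -- good p-port z
        rw [Finset.mem_insert, Finset.mem_singleton] at hz
        have t4 := mul_nonneg huv hd1
        rcases hz with hz | hz <;> rw [hz] at hgood
        · have t1 : 0 ≤ (1 - u) * v * ((prodBernoulli wQ).real (openConn q₁ b) - (prodBernoulli wQ).real (openConn p₁ b)) :=
            mul_nonneg h1uv (by linarith [hgood])
          have t2 : 0 ≤ (1 - u) * (1 - v) * ((prodBernoulli w).real (openConn j b) - (prodBernoulli w).real (openConn p₁ b)) :=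
            mul_nonneg h1u1v (by linarith [gp1])
          have key : u * (1 - v) * aP + (1 - u) * v * aQ + u * v * dM =
              (1 - u) * v * ((prodBernoulli wQ).real (openConn q₁ b) - (prodBernoulli wQ).real (openConn p₁ b)) +
              (1 - u) * (1 - v) * ((prodBernoulli w).real (openConn j b) - (prodBernoulli w).real (openConn p₁ b)) +
              ((1 - u) * (1 - v) * ((prodBernoulli w).real (openConn p₁ b) - (prodBernoulli w).real (openConn j b)) +
                u * (1 - v) * aP +
                (1 - u) * v * ((prodBernoulli wQ).real (openConn p₁ b) - (prodBernoulli wQ).real (openConn j b)) +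
                u * v * bP) +
              u * v * (dM - bP) := by rw [haQ]; ring
          rw [key]
          exact add_nonneg (add_nonneg (add_nonneg t1 t2) hr1) t4
        · have t1 : 0 ≤ (1 - u) * v * ((prodBernoulli wQ).real (openConn q₁ b) - (prodBernoulli wQ).real (openConn p₂ b)) :=
            mul_nonneg h1uv (by linarith [hgood])
          have t2 : 0 ≤ (1 - u) * (1 - v) * ((prodBernoulli w).real (openConn j b) - (prodBernoulli w).real (openConn p₂ b)) :=
            mul_nonneg h1u1v (by linarith [gp2])
          have key : u * (1 - v) * aP + (1 - u) * v * aQ + u * v * dM =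
              (1 - u) * v * ((prodBernoulli wQ).real (openConn q₁ b) - (prodBernoulli wQ).real (openConn p₂ b)) +
              (1 - u) * (1 - v) * ((prodBernoulli w).real (openConn j b) - (prodBernoulli w).real (openConn p₂ b)) +
              ((1 - u) * (1 - v) * ((prodBernoulli w).real (openConn p₂ b) - (prodBernoulli w).real (openConn j b)) +
                u * (1 - v) * aP +
                (1 - u) * v * ((prodBernoulli wQ).real (openConn p₂ b) - (prodBernoulli wQ).real (openConn j b)) +
                u * v * bP) +
              u * v * (dM - bP) := by rw [haQ]; ring
          rw [key]
          exact add_nonneg (add_nonneg (add_nonneg t1 t2) hr2) t4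
      · -- good q-port z
        rw [Finset.mem_insert, Finset.mem_singleton] at hz
        have t4 := mul_nonneg huv hd2
        rcases hz with hz | hz <;> rw [hz] at hgood
        · have t1 : 0 ≤ u * (1 - v) * ((prodBernoulli wP).real (openConn p₁ b) - (prodBernoulli wP).real (openConn q₁ b)) :=
            mul_nonneg hu1v (by linarith [hgood])
          have t2 : 0 ≤ (1 - u) * (1 - v) * ((prodBernoulli w).real (openConn j b) - (prodBernoulli w).real (openConn q₁ b)) :=
            mul_nonneg h1u1v (by linarith [gq1])
          have key : u * (1 - v) * aP + (1 - u) * v * aQ + u * v * dM =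
              u * (1 - v) * ((prodBernoulli wP).real (openConn p₁ b) - (prodBernoulli wP).real (openConn q₁ b)) +
              (1 - u) * (1 - v) * ((prodBernoulli w).real (openConn j b) - (prodBernoulli w).real (openConn q₁ b)) +
              ((1 - u) * (1 - v) * ((prodBernoulli w).real (openConn q₁ b) - (prodBernoulli w).real (openConn j b)) +
                u * (1 - v) * ((prodBernoulli wP).real (openConn q₁ b) - (prodBernoulli wP).real (openConn j b)) +
                (1 - u) * v * aQ +
                u * v * bQ) +
              u * v * (dM - bQ) := by rw [haP]; ring
          rw [key]
          exact add_nonneg (add_nonneg (add_nonneg t1 t2) hr3) t4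
        · have t1 : 0 ≤ u * (1 - v) * ((prodBernoulli wP).real (openConn p₁ b) - (prodBernoulli wP).real (openConn q₂ b)) :=
            mul_nonneg hu1v (by linarith [hgood])
          have t2 : 0 ≤ (1 - u) * (1 - v) * ((prodBernoulli w).real (openConn j b) - (prodBernoulli w).real (openConn q₂ b)) :=
            mul_nonneg h1u1v (by linarith [gq2])
          have key : u * (1 - v) * aP + (1 - u) * v * aQ + u * v * dM =
              u * (1 - v) * ((prodBernoulli wP).real (openConn p₁ b) - (prodBernoulli wP).real (openConn q₂ b)) +
              (1 - u) * (1 - v) * ((prodBernoulli w).real (openConn j b) - (prodBernoulli w).real (openConn q₂ b)) +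
              ((1 - u) * (1 - v) * ((prodBernoulli w).real (openConn q₂ b) - (prodBernoulli w).real (openConn j b)) +
                u * (1 - v) * ((prodBernoulli wP).real (openConn q₂ b) - (prodBernoulli wP).real (openConn j b)) +
                (1 - u) * v * aQ +
                u * v * bQ) +
              u * v * (dM - bQ) := by rw [haP]; ring
          rw [key]
          exact add_nonneg (add_nonneg (add_nonneg t1 t2) hr4) t4

end UpsetExchange

end

end Summit.CriticalPhenomena.PercolationContinuityZ3.Theorems
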